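import Literature.Topology.FourManifolds.LefschetzBasePages
import Literature.Topology.PlaneTopology.ChartParity
import HarnessLib

/-!
# The page twisting is locally constant along non-vanishing `C¹` families
(wave 2, brick (M3b) of stub `stub_modelsOnFibred_of_reach` = NF4
`Literature.Topology.FourManifolds.LefschetzBase.modelsOnFibred_of_reach`, line `modp-braid-orbits`
r11, crux `ConvexBisection.AcyclicBisectionExists`, item stmt-SmoothPoincare4-10508; registered
sub-goal `helper_pageTwisting_eq_of_nonvanishing_family`)

The page twisting `pageTwisting g K ν = wind (pageTwistingLoop g K ν)` of a framing `ν` of a loop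
`K : 𝕊¹ → Base g` (`LefschetzBasePages.lean` §6) is the winding number of the twisting loop
`t ↦ (⟪ν, i K'⟫, ⟪ν, n(K)⟫)` (`K' = deriv (ambCurve g K)` the ambient velocity of the unit-period
parametrisation, `ν` read in `ℝ⁴` through `ambient g`, `n = horizNormal g`).  Along a family
`(K_s, ν_s)`, `s ∈ [0, 1]`, whose twisting loops vary continuously and never vanish — which is what
"`K_s` stays in the pages and `ν_s` stays transverse to the page framing" delivers — the page
twisting is constant, by the free-homotopy invariance of the winding number
(`Literature.Topology.PlaneTopology.wind_eq_of_homotopy`, `ChartParity.lean`):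

* §1 `pageTwistingLoop_add_one` — the twisting loop has period `1` (no differentiability needed:
  `deriv` of a `1`-periodic function is `1`-periodic);
* §2 `helper_pageTwisting_eq_of_nonvanishing_family` / `pageTwisting_eq_of_continuousOn_family` —
  the abstract form: joint continuity of `(s, t) ↦ pageTwistingLoop g (K s) (ν s) t` on `[0, 1]²`
  and non-vanishing there give `pageTwisting g (K 0) (ν 0) = pageTwisting g (K 1) (ν 1)`;
* §3 continuity of the ingredients: `continuous_cplxJ`, `continuousOn_horizNormal` (off the origin,
  which `Base g` avoids: `coe_ne_zero`), `continuous_ambient` (`ambient g` is the fibre part of the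
  tangent map of the smooth inclusion `Base g ↪ ℝ⁴`, continuous on `TangentBundle (𝓡∂ 4) (Base g)`);
* §4 `pageTwisting_eq_of_family` — the structured form: the loops `(s, θ) ↦ K_s θ` continuous on
  `[0, 1] × 𝕊¹`, the ambient framing vectors `(s, t) ↦ ambient g (K_s (e^{2πit})) (ν_s (e^{2πit}))`
  and the ambient velocities `(s, t) ↦ deriv (ambCurve g K_s) t` continuous on `[0, 1] × ℝ` (the
  honest `C¹` hypothesis), no twisting loop vanishing; `pageTwisting_eq_of_bundle_family` — the
  same with the framings given, as in the tree (`IsKnotFraming.continuous`), by a continuous map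
  into the tangent bundle; `continuousOn_deriv_of_contDiff_family` — the velocity hypothesis from a
  jointly `C¹` ambient family;
* §5 `pageTwisting_comp_ambientIsotopy` — transport along an ambient isotopy `R` of `Base g`: the
  moved framed loops `(R_s ∘ K, dR_s(ν))` of a `C¹` loop (the data of `HandleAttachingMap.transport`)
  satisfy both regularity hypotheses (`continuous_mfderiv_ambientIsotopy_bundle`, via Mathlib's
  `equivTangentBundleProd`; `contDiff_ambCurve_ambientIsotopy`), so ONLY the non-vanishing of the
  twisting loops along the way (fibredness of `R` near `K`) remains for `pageTwisting` to persist.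

Everything is proved; no named facts, no `sorry`.  The circle is written
`sphere (0 : EuclideanSpace ℝ (Fin 2)) 1` and `ℝ⁴` as `EuclideanSpace ℝ (Fin 4)` throughout (no
local notation in `Theorems/`).  References: W. Fulton, *Algebraic Topology: A First Course*
(1995), §3 (homotopy invariance of winding numbers); J. B. Etnyre, T. Fuller,
*Realizing 4-manifolds as achiral Lefschetz fibrations*, IMRN 2006, §2 [EtnyreFuller2006].
-/

noncomputable section

set_option linter.dupNamespace false

open scoped Manifold ContDiff Topology Bundle ComplexConjugate
open Set Function Metric Bundle
open Literature.Topology.FourManifolds Literature.Topology.FourManifolds.LefschetzBase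
  Literature.Topology.PlaneTopology

namespace Summit.SmoothPoincare4.SmoothPoincare4.Theorems.AcyclicBisectionExists.ModpBraidOrbits

variable {g : ℕ}
  -- a single framed loop
  {L : sphere (0 : EuclideanSpace ℝ (Fin 2)) 1 → Base g}
  {μ : sphere (0 : EuclideanSpace ℝ (Fin 2)) 1 → EuclideanSpace ℝ (Fin 4)}
  -- a family of framed loops, `s ∈ ℝ` (only `s ∈ [0, 1]` matters)
  {K : ℝ → sphere (0 : EuclideanSpace ℝ (Fin 2)) 1 → Base g}
  {ν : ℝ → sphere (0 : EuclideanSpace ℝ (Fin 2)) 1 → EuclideanSpace ℝ (Fin 4)}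

/-! ## §1 The twisting loop has period `1` -/

/-- The ambient unit-period parametrisation has period `1`. [folklore] -/
theorem ambCurve_add_one (t : ℝ) : ambCurve g L (t + 1) = ambCurve g L t := by
  unfold ambCurve
  rw [circlePt_add_one]

/-- The ambient velocity has period `1` (the derivative of a `1`-periodic function, no
differentiability needed). [folklore] -/
theorem deriv_ambCurve_add_one (t : ℝ) : deriv (ambCurve g L) (t + 1) = deriv (ambCurve g L) t := by
  have h : ambCurve g L = fun s => ambCurve g L (s + 1) := funext fun s => (ambCurve_add_one s).symm
  conv_rhs => rw [h, deriv_comp_add_const]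

/-- **The twisting loop has period `1`.** [folklore] -/
theorem pageTwistingLoop_add_one (t : ℝ) :
    pageTwistingLoop g L μ (t + 1) = pageTwistingLoop g L μ t := by
  unfold pageTwistingLoop
  rw [deriv_ambCurve_add_one, ambCurve_add_one, circlePt_add_one]

/-- The twisting loop closes up on `[0, 1]`. [folklore] -/
theorem pageTwistingLoop_zero_eq_one : pageTwistingLoop g L μ 0 = pageTwistingLoop g L μ 1 := by
  rw [← pageTwistingLoop_add_one 0, zero_add]

/-! ## §2 The abstract form: continuous non-vanishing families of twisting loops -/

/-- **Sub-goal `helper_pageTwisting_eq_of_nonvanishing_family` of stub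
`stub_modelsOnFibred_of_reach`** (NF4, wave 2, brick (M3b)): if the twisting loops of a family
`(K_s, ν_s)` depend continuously on `(s, t) ∈ [0, 1]²` and never vanish there, then
`pageTwisting g (K 0) (ν 0) = pageTwisting g (K 1) (ν 1)` (free-homotopy invariance of the winding
number; the loops close up by `pageTwistingLoop_zero_eq_one`). [cite: EtnyreFuller2006, §2] -/
theorem helper_pageTwisting_eq_of_nonvanishing_family :
    ∀ (g : ℕ) (K : ℝ → Metric.sphere (0 : EuclideanSpace ℝ (Fin 2)) 1 →
        Literature.Topology.FourManifolds.LefschetzBase.Base g)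
      (ν : ℝ → Metric.sphere (0 : EuclideanSpace ℝ (Fin 2)) 1 → EuclideanSpace ℝ (Fin 4)),
      ContinuousOn (fun p : ℝ × ℝ =>
          Literature.Topology.FourManifolds.LefschetzBase.pageTwistingLoop g (K p.1) (ν p.1) p.2)
        (Set.Icc (0 : ℝ) 1 ×ˢ Set.Icc (0 : ℝ) 1) →
      (∀ s ∈ Set.Icc (0 : ℝ) 1, ∀ t ∈ Set.Icc (0 : ℝ) 1,
          Literature.Topology.FourManifolds.LefschetzBase.pageTwistingLoop g (K s) (ν s) t ≠ 0) →
      Literature.Topology.FourManifolds.LefschetzBase.pageTwisting g (K 0) (ν 0) =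
        Literature.Topology.FourManifolds.LefschetzBase.pageTwisting g (K 1) (ν 1) :=
  fun g K ν hc hne => wind_eq_of_homotopy (H := fun s t => pageTwistingLoop g (K s) (ν s) t) hc
    (fun _ _ => pageTwistingLoop_zero_eq_one) hne

/-- **Continuous non-vanishing families of twisting loops have constant page twisting** (dot-free
form of `helper_pageTwisting_eq_of_nonvanishing_family`). [cite: EtnyreFuller2006, §2] -/
theorem pageTwisting_eq_of_continuousOn_family
    (hc : ContinuousOn (fun p : ℝ × ℝ => pageTwistingLoop g (K p.1) (ν p.1) p.2)
      (Icc (0 : ℝ) 1 ×ˢ Icc (0 : ℝ) 1))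
    (hne : ∀ s ∈ Icc (0 : ℝ) 1, ∀ t ∈ Icc (0 : ℝ) 1, pageTwistingLoop g (K s) (ν s) t ≠ 0) :
    pageTwisting g (K 0) (ν 0) = pageTwisting g (K 1) (ν 1) :=
  helper_pageTwisting_eq_of_nonvanishing_family g K ν hc hne

/-! ## §3 Continuity of the ingredients of the twisting loop -/

/-- The complex structure `cplxJ` of `ℂ² = ℝ⁴` is continuous. [folklore] -/
theorem continuous_cplxJ : Continuous cplxJ := by
  unfold cplxJ
  exact continuous_mk.comp ((continuous_const.mul contDiff_cx.continuous).prodMk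
    (continuous_const.mul contDiff_cy.continuous))

/-- `dPhiX g` is continuous. [folklore] -/
theorem continuous_dPhiX (g : ℕ) : Continuous (dPhiX g) := by
  unfold dPhiX
  exact (continuous_const.mul (contDiff_cx.continuous.pow _)).neg

/-- `dPhiY` is continuous. [folklore] -/
theorem continuous_dPhiY : Continuous dPhiY := by
  unfold dPhiY
  exact continuous_const.mul contDiff_cy.continuous

/-- Off the origin the differential `dΦ = (a, b)` does not vanish: `‖a‖² + ‖b‖² ≠ 0`
(`b = 2y = 0` and `a = −(2g+1)x^{2g} = 0` force `x = y = 0` when `g ≠ 0`, and `a = −1` when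
`g = 0`). [folklore] -/
theorem normSq_dPhi_ne_zero {q : EuclideanSpace ℝ (Fin 4)} (hq : q ≠ 0) :
    ‖dPhiX g q‖ ^ 2 + ‖dPhiY q‖ ^ 2 ≠ 0 := by
  intro h
  have ha : dPhiX g q = 0 := by
    rw [← norm_eq_zero, ← sq_eq_zero_iff]; nlinarith [sq_nonneg ‖dPhiX g q‖, sq_nonneg ‖dPhiY q‖]
  have hb : dPhiY q = 0 := by
    rw [← norm_eq_zero, ← sq_eq_zero_iff]; nlinarith [sq_nonneg ‖dPhiX g q‖, sq_nonneg ‖dPhiY q‖]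
  have hy : cy q = 0 := by unfold dPhiY at hb; simpa using hb
  have hx : cx q = 0 := by
    unfold dPhiX at ha
    rw [neg_eq_zero, mul_eq_zero] at ha
    exact ha.elim (fun ha => absurd ha (Nat.cast_ne_zero.2 (Nat.succ_ne_zero _)))
      eq_zero_of_pow_eq_zero
  exact hq (by rw [← mk_cx_cy q, hx, hy, mk_zero])

/-- **The horizontal normal `horizNormal g` is continuous off the origin.** [folklore] -/
theorem continuousOn_horizNormal (g : ℕ) :
    ContinuousOn (horizNormal g) {q : EuclideanSpace ℝ (Fin 4) | q ≠ 0} := by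
  have hden : Continuous fun q : EuclideanSpace ℝ (Fin 4) =>
      ((‖dPhiX g q‖ ^ 2 + ‖dPhiY q‖ ^ 2 : ℝ) : ℂ) :=
    Complex.continuous_ofReal.comp (((continuous_dPhiX g).norm.pow 2).add
      (continuous_dPhiY.norm.pow 2))
  have hlam : ContinuousOn (fun q : EuclideanSpace ℝ (Fin 4) =>
      Complex.I * w g q / ((‖dPhiX g q‖ ^ 2 + ‖dPhiY q‖ ^ 2 : ℝ) : ℂ))
      {q : EuclideanSpace ℝ (Fin 4) | q ≠ 0} :=
    (continuous_const.mul (contDiff_w g).continuous).continuousOn.div hden.continuousOn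
      fun q hq => by exact_mod_cast normSq_dPhi_ne_zero hq
  exact continuous_mk.comp_continuousOn
    ((hlam.mul (Complex.continuous_conj.comp (continuous_dPhiX g)).continuousOn).prodMk
      (hlam.mul (Complex.continuous_conj.comp continuous_dPhiY).continuousOn))

/-- **Points of the base are not the origin** (`rho g 0 = 1 > 1/4`). [folklore] -/
theorem coe_ne_zero (x : Base g) : (x.1 : EuclideanSpace ℝ (Fin 4)) ≠ 0 := by
  intro h
  have hx : rho g x.1 ≤ 1 / 4 := x.2
  rw [h, rho_zero] at hx
  norm_num at hx

/-- **The horizontal normal along the base, `x ↦ n(x)`, is continuous.** [folklore] -/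
theorem continuous_horizNormal_coe : Continuous fun x : Base g => horizNormal g x.1 :=
  (continuousOn_horizNormal g).comp_continuous continuous_subtype_val coe_ne_zero

/-- **`ambient g` is continuous on the tangent bundle**: `(x, v) ↦ ambient g x v = d(incl)_x v` is
the fibre component of the tangent map of the smooth inclusion `Base g ↪ ℝ⁴`, read in the trivial
tangent bundle of `ℝ⁴`. [folklore] -/
theorem continuous_ambient :
    Continuous fun p : TangentBundle (𝓡∂ 4) (Base g) => ambient g p.proj p.2 := by
  have h1 : Continuous (tangentMap (𝓡∂ 4) (𝓡 4) (RegularSublevel.incl (isRegularLevel_rho g))) :=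
    (RegularSublevel.contMDiff_incl (isRegularLevel_rho g)).continuous_tangentMap (by simp)
  have h2 : Continuous fun q : TangentBundle (𝓡 4) (EuclideanSpace ℝ (Fin 4)) => q.2 :=
    (contMDiff_snd_tangentBundle_modelSpace (n := 0) (EuclideanSpace ℝ (Fin 4)) (𝓡 4)).continuous
  exact h2.comp h1

/-- A framing family given as a continuous map into the tangent bundle has continuous ambient
vectors. [folklore] -/
theorem continuousOn_ambient_of_bundle {S : Set (ℝ × sphere (0 : EuclideanSpace ℝ (Fin 2)) 1)}
    (hKν : ContinuousOn (fun p : ℝ × sphere (0 : EuclideanSpace ℝ (Fin 2)) 1 =>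
      (TotalSpace.mk' (EuclideanSpace ℝ (Fin 4)) (K p.1 p.2) (ν p.1 p.2) :
        TangentBundle (𝓡∂ 4) (Base g))) S) :
    ContinuousOn (fun p : ℝ × sphere (0 : EuclideanSpace ℝ (Fin 2)) 1 =>
      ambient g (K p.1 p.2) (ν p.1 p.2)) S :=
  continuous_ambient.comp_continuousOn hKν

/-- A framing family given as a continuous map into the tangent bundle has a continuous family of
base loops. [folklore] -/
theorem continuousOn_base_of_bundle {S : Set (ℝ × sphere (0 : EuclideanSpace ℝ (Fin 2)) 1)}
    (hKν : ContinuousOn (fun p : ℝ × sphere (0 : EuclideanSpace ℝ (Fin 2)) 1 =>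
      (TotalSpace.mk' (EuclideanSpace ℝ (Fin 4)) (K p.1 p.2) (ν p.1 p.2) :
        TangentBundle (𝓡∂ 4) (Base g))) S) :
    ContinuousOn (uncurry K) S :=
  (FiberBundle.continuous_proj (EuclideanSpace ℝ (Fin 4)) (TangentSpace (𝓡∂ 4))).comp_continuousOn
    hKν

/-! ## §4 The structured form: `C¹` families of loops with continuous framings -/

/-- **The twisting loops of a family are jointly continuous** when the loops `(s, θ) ↦ K_s θ` are
continuous on `[0, 1] × 𝕊¹`, the ambient framing vectors
`(s, t) ↦ ambient g (K_s (e^{2πit})) (ν_s (e^{2πit}))` and the ambient velocities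
`(s, t) ↦ deriv (ambCurve g K_s) t` are continuous on `[0, 1] × ℝ`. [folklore] -/
theorem continuousOn_pageTwistingLoop_family
    (hK : ContinuousOn (uncurry K) (Icc (0 : ℝ) 1 ×ˢ univ))
    (hA : ContinuousOn (fun p : ℝ × ℝ => ambient g (K p.1 (circlePt p.2)) (ν p.1 (circlePt p.2)))
      (Icc (0 : ℝ) 1 ×ˢ univ))
    (hd : ContinuousOn (fun p : ℝ × ℝ => deriv (ambCurve g (K p.1)) p.2) (Icc (0 : ℝ) 1 ×ˢ univ)) :
    ContinuousOn (fun p : ℝ × ℝ => pageTwistingLoop g (K p.1) (ν p.1) p.2)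
      (Icc (0 : ℝ) 1 ×ˢ univ) := by
  -- the base points `(s, t) ↦ K_s (e^{2πit})`
  have hKc : ContinuousOn (fun p : ℝ × ℝ => K p.1 (circlePt p.2)) (Icc (0 : ℝ) 1 ×ˢ univ) :=
    hK.comp (continuous_fst.prodMk (continuous_circlePt.comp continuous_snd)).continuousOn
      fun p hp => ⟨hp.1, mem_univ _⟩
  -- the horizontal normal along them
  have hn : ContinuousOn (fun p : ℝ × ℝ => horizNormal g (ambCurve g (K p.1) p.2))
      (Icc (0 : ℝ) 1 ×ˢ univ) :=
    continuous_horizNormal_coe.comp_continuousOn hKc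
  -- the two coordinates, and the assembled complex number
  have hre : ContinuousOn (fun p : ℝ × ℝ =>
      inner ℝ (ambient g (K p.1 (circlePt p.2)) (ν p.1 (circlePt p.2)))
        (cplxJ (deriv (ambCurve g (K p.1)) p.2))) (Icc (0 : ℝ) 1 ×ˢ univ) :=
    hA.inner (continuous_cplxJ.comp_continuousOn hd)
  have him : ContinuousOn (fun p : ℝ × ℝ =>
      inner ℝ (ambient g (K p.1 (circlePt p.2)) (ν p.1 (circlePt p.2)))
        (horizNormal g (ambCurve g (K p.1) p.2))) (Icc (0 : ℝ) 1 ×ˢ univ) :=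
    hA.inner hn
  have hform : (fun p : ℝ × ℝ => pageTwistingLoop g (K p.1) (ν p.1) p.2) = fun p =>
      ((inner ℝ (ambient g (K p.1 (circlePt p.2)) (ν p.1 (circlePt p.2)))
          (cplxJ (deriv (ambCurve g (K p.1)) p.2)) : ℝ) : ℂ) +
        ((inner ℝ (ambient g (K p.1 (circlePt p.2)) (ν p.1 (circlePt p.2)))
          (horizNormal g (ambCurve g (K p.1) p.2)) : ℝ) : ℂ) * Complex.I := by
    funext p
    rw [← Complex.mk_eq_add_mul_I]
    rfl
  rw [hform]
  exact (Complex.continuous_ofReal.comp_continuousOn hre).add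
    ((Complex.continuous_ofReal.comp_continuousOn him).mul continuousOn_const)

/-- **The page twisting is constant along non-vanishing `C¹` families**: if the loops
`(s, θ) ↦ K_s θ` are continuous on `[0, 1] × 𝕊¹`, the ambient framing vectors and the ambient
velocities are continuous on `[0, 1] × ℝ`, and no twisting loop `pageTwistingLoop g K_s ν_s`,
`s ∈ [0, 1]`, vanishes on `[0, 1]`, then `pageTwisting g (K 0) (ν 0) = pageTwisting g (K 1) (ν 1)`.
[cite: EtnyreFuller2006, §2] -/
theorem pageTwisting_eq_of_family
    (hK : ContinuousOn (uncurry K) (Icc (0 : ℝ) 1 ×ˢ univ))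
    (hA : ContinuousOn (fun p : ℝ × ℝ => ambient g (K p.1 (circlePt p.2)) (ν p.1 (circlePt p.2)))
      (Icc (0 : ℝ) 1 ×ˢ univ))
    (hd : ContinuousOn (fun p : ℝ × ℝ => deriv (ambCurve g (K p.1)) p.2) (Icc (0 : ℝ) 1 ×ˢ univ))
    (hne : ∀ s ∈ Icc (0 : ℝ) 1, ∀ t ∈ Icc (0 : ℝ) 1, pageTwistingLoop g (K s) (ν s) t ≠ 0) :
    pageTwisting g (K 0) (ν 0) = pageTwisting g (K 1) (ν 1) :=
  pageTwisting_eq_of_continuousOn_family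
    ((continuousOn_pageTwistingLoop_family hK hA hd).mono (prod_mono Subset.rfl (subset_univ _))) hne

/-- **The page twisting is constant along non-vanishing `C¹` families, bundle form**: the framing
family is a continuous map `(s, θ) ↦ (K_s θ, ν_s θ)` into the tangent bundle of the base on
`[0, 1] × 𝕊¹` (as in `IsKnotFraming.continuous`), the ambient velocities
`(s, t) ↦ deriv (ambCurve g K_s) t` are continuous on `[0, 1] × ℝ`, and no twisting loop vanishes.
[cite: EtnyreFuller2006, §2] -/
theorem pageTwisting_eq_of_bundle_family
    (hKν : ContinuousOn (fun p : ℝ × sphere (0 : EuclideanSpace ℝ (Fin 2)) 1 =>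
      (TotalSpace.mk' (EuclideanSpace ℝ (Fin 4)) (K p.1 p.2) (ν p.1 p.2) :
        TangentBundle (𝓡∂ 4) (Base g))) (Icc (0 : ℝ) 1 ×ˢ univ))
    (hd : ContinuousOn (fun p : ℝ × ℝ => deriv (ambCurve g (K p.1)) p.2) (Icc (0 : ℝ) 1 ×ˢ univ))
    (hne : ∀ s ∈ Icc (0 : ℝ) 1, ∀ t ∈ Icc (0 : ℝ) 1, pageTwistingLoop g (K s) (ν s) t ≠ 0) :
    pageTwisting g (K 0) (ν 0) = pageTwisting g (K 1) (ν 1) := by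
  refine pageTwisting_eq_of_family (continuousOn_base_of_bundle hKν) ?_ hd hne
  exact (continuousOn_ambient_of_bundle hKν).comp
    (continuous_fst.prodMk (continuous_circlePt.comp continuous_snd)).continuousOn
    fun p hp => ⟨hp.1, mem_univ _⟩

/-- **The velocity hypothesis from a jointly `C¹` ambient family**: if
`F (s, t) = ambCurve g K_s t ∈ ℝ⁴` is `C¹` on `ℝ²`, then `(s, t) ↦ deriv (ambCurve g K_s) t =
∂_t F (s, t)` is continuous. [folklore] -/
theorem continuousOn_deriv_of_contDiff_family
    (hF : ContDiff ℝ 1 fun p : ℝ × ℝ => ambCurve g (K p.1) p.2) (S : Set (ℝ × ℝ)) :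
    ContinuousOn (fun p : ℝ × ℝ => deriv (ambCurve g (K p.1)) p.2) S := by
  set F : ℝ × ℝ → EuclideanSpace ℝ (Fin 4) := fun p => ambCurve g (K p.1) p.2 with hFdef
  have hderiv : ∀ p : ℝ × ℝ, deriv (ambCurve g (K p.1)) p.2 = fderiv ℝ F p ((0 : ℝ), (1 : ℝ)) := by
    rintro ⟨s, t⟩
    have hc : HasDerivAt (fun u : ℝ => ((s, u) : ℝ × ℝ)) ((0 : ℝ), (1 : ℝ)) t :=
      (hasDerivAt_const t s).prodMk (hasDerivAt_id t)
    have hFd : HasFDerivAt F (fderiv ℝ F (s, t)) (s, t) :=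
      ((hF.differentiable one_ne_zero) (s, t)).hasFDerivAt
    have hcomp := hFd.comp_hasDerivAt t hc
    have e : (F ∘ fun u : ℝ => ((s, u) : ℝ × ℝ)) = ambCurve g (K s) := rfl
    rw [e] at hcomp
    exact hcomp.deriv
  have hcont : Continuous fun p : ℝ × ℝ => fderiv ℝ F p ((0 : ℝ), (1 : ℝ)) :=
    (hF.continuous_fderiv one_ne_zero).clm_apply continuous_const
  simp_rw [hderiv]
  exact hcont.continuousOn

/-! ## §5 Transport along an ambient isotopy of the base -/

/-- **The pushed-forward framings `dR_s(μ)` along the moved loops `R_s ∘ L` form a continuous family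
in the tangent bundle**: `(s, θ) ↦ (R_s (L θ), dR_s (μ θ))` is the tangent map of the jointly smooth
`(s, x) ↦ R_s x` evaluated on the continuous section `(s, θ) ↦ ((s, L θ), (0, μ θ))` of
`T(ℝ × Base g) ≅ Tℝ × T(Base g)` (`equivTangentBundleProd`). [folklore] -/
theorem continuous_mfderiv_ambientIsotopy_bundle (R : AmbientIsotopy (𝓡∂ 4) (Base g))
    (hμ : Continuous fun θ => (TotalSpace.mk' (EuclideanSpace ℝ (Fin 4)) (L θ) (μ θ) :
      TangentBundle (𝓡∂ 4) (Base g))) :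
    Continuous fun p : ℝ × sphere (0 : EuclideanSpace ℝ (Fin 2)) 1 =>
      (TotalSpace.mk' (EuclideanSpace ℝ (Fin 4)) (R.toFun p.1 (L p.2))
        (mfderiv (𝓡∂ 4) (𝓡∂ 4) (R.toFun p.1) (L p.2) (μ p.2)) : TangentBundle (𝓡∂ 4) (Base g)) := by
  set e := equivTangentBundleProd 𝓘(ℝ, ℝ) ℝ (𝓡∂ 4) (Base g) with he
  have key : (fun p : ℝ × sphere (0 : EuclideanSpace ℝ (Fin 2)) 1 =>
      (TotalSpace.mk' (EuclideanSpace ℝ (Fin 4)) (R.toFun p.1 (L p.2))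
        (mfderiv (𝓡∂ 4) (𝓡∂ 4) (R.toFun p.1) (L p.2) (μ p.2)) : TangentBundle (𝓡∂ 4) (Base g))) =
      fun p => tangentMap (𝓘(ℝ, ℝ).prod (𝓡∂ 4)) (𝓡∂ 4) (uncurry R.toFun)
        (e.symm ((⟨p.1, (0 : ℝ)⟩ : TangentBundle 𝓘(ℝ, ℝ) ℝ),
          (TotalSpace.mk' (EuclideanSpace ℝ (Fin 4)) (L p.2) (μ p.2) :
            TangentBundle (𝓡∂ 4) (Base g)))) := by
    funext p
    have hg : MDifferentiableAt (𝓘(ℝ, ℝ).prod (𝓡∂ 4)) (𝓡∂ 4) (uncurry R.toFun) (p.1, L p.2) :=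
      R.contMDiff.mdifferentiableAt (by simp)
    have hf : MDifferentiableAt (𝓡∂ 4) (𝓘(ℝ, ℝ).prod (𝓡∂ 4)) (fun y : Base g => (p.1, y)) (L p.2) :=
      mdifferentiableAt_const.prodMk mdifferentiableAt_id
    have h := tangentMap_comp_at (TotalSpace.mk' (EuclideanSpace ℝ (Fin 4)) (L p.2) (μ p.2) :
      TangentBundle (𝓡∂ 4) (Base g)) hg hf
    rw [tangentMap_prod_right] at h
    exact h
  rw [key]
  have h3 : Continuous fun s : ℝ => ((⟨s, (0 : ℝ)⟩ : TangentBundle 𝓘(ℝ, ℝ) ℝ)) :=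
    (tangentBundleModelSpaceHomeomorph 𝓘(ℝ, ℝ)).symm.continuous.comp
      (continuous_id.prodMk continuous_const)
  exact (R.contMDiff.continuous_tangentMap (by simp)).comp
    ((contMDiff_equivTangentBundleProd_symm (n := 0)).continuous.comp
      ((h3.comp continuous_fst).prodMk (hμ.comp continuous_snd)))

/-- **The moved loops of a `C¹` loop under an ambient isotopy form a jointly `C¹` ambient family**:
`(s, t) ↦ ambCurve g (R_s ∘ L) t = incl (R_s (L (e^{2πit}))) ∈ ℝ⁴` is `C¹` on `ℝ²`. [folklore] -/
theorem contDiff_ambCurve_ambientIsotopy (R : AmbientIsotopy (𝓡∂ 4) (Base g))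
    (hL : ContMDiff (𝓡 1) (𝓡∂ 4) 1 L) :
    ContDiff ℝ 1 fun p : ℝ × ℝ => ambCurve g (R.toFun p.1 ∘ L) p.2 := by
  have hR : ContMDiff (𝓘(ℝ, ℝ).prod (𝓡∂ 4)) (𝓡∂ 4) 1 (uncurry R.toFun) := R.contMDiff.of_le (by simp)
  have hLc : ContMDiff 𝓘(ℝ, ℝ) (𝓡∂ 4) 1 (L ∘ circlePt) := hL.comp (contMDiff_circlePt.of_le (by simp))
  have hpair : ContMDiff (𝓘(ℝ, ℝ).prod 𝓘(ℝ, ℝ)) (𝓘(ℝ, ℝ).prod (𝓡∂ 4)) 1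
      (fun p : ℝ × ℝ => (p.1, L (circlePt p.2))) :=
    contMDiff_fst.prodMk (hLc.comp contMDiff_snd)
  have hincl : ContMDiff (𝓡∂ 4) (𝓡 4) 1 (RegularSublevel.incl (isRegularLevel_rho g)) :=
    (RegularSublevel.contMDiff_incl (isRegularLevel_rho g)).of_le (by simp)
  have h : ContMDiff (𝓘(ℝ, ℝ).prod 𝓘(ℝ, ℝ)) (𝓡 4) 1
      (fun p : ℝ × ℝ => ambCurve g (R.toFun p.1 ∘ L) p.2) :=
    hincl.comp (hR.comp hpair)
  rw [← contMDiff_iff_contDiff, modelWithCornersSelf_prod, ← chartedSpaceSelf_prod]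
  exact h

/-- **Transport of the page twisting along an ambient isotopy of the base**: for a `C¹` loop `L`
with a framing `μ` (continuous into the tangent bundle) and an ambient isotopy `R` of `Base g`,
if no twisting loop of the moved framed loops `(R_s ∘ L, dR_s(μ))`, `s ∈ [0, 1]`, vanishes on
`[0, 1]` (e.g. `R` is fibred near `L` and `μ` is a framing of `L` in `∂ Base g`), then the end
`(R_1 ∘ L, dR_1(μ))` — the attaching circle and handle framing of the transported attaching map
(`attachingCircle_transport`, `attachingFraming_transport`) — has the page twisting of `(L, μ)`.
[cite: EtnyreFuller2006, §2] -/
theorem pageTwisting_comp_ambientIsotopy (R : AmbientIsotopy (𝓡∂ 4) (Base g))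
    (hL : ContMDiff (𝓡 1) (𝓡∂ 4) 1 L)
    (hμ : Continuous fun θ => (TotalSpace.mk' (EuclideanSpace ℝ (Fin 4)) (L θ) (μ θ) :
      TangentBundle (𝓡∂ 4) (Base g)))
    (hne : ∀ s ∈ Icc (0 : ℝ) 1, ∀ t ∈ Icc (0 : ℝ) 1, pageTwistingLoop g (R.toFun s ∘ L)
      (fun θ => mfderiv (𝓡∂ 4) (𝓡∂ 4) (R.toFun s) (L θ) (μ θ)) t ≠ 0) :
    pageTwisting g (R.toFun 1 ∘ L) (fun θ => mfderiv (𝓡∂ 4) (𝓡∂ 4) (R.toFun 1) (L θ) (μ θ)) =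
      pageTwisting g L μ := by
  have key : pageTwisting g (R.toFun 0 ∘ L) (fun θ => mfderiv (𝓡∂ 4) (𝓡∂ 4) (R.toFun 0) (L θ) (μ θ)) =
      pageTwisting g (R.toFun 1 ∘ L) (fun θ => mfderiv (𝓡∂ 4) (𝓡∂ 4) (R.toFun 1) (L θ) (μ θ)) :=
    pageTwisting_eq_of_bundle_family (K := fun s => R.toFun s ∘ L)
      (ν := fun s θ => mfderiv (𝓡∂ 4) (𝓡∂ 4) (R.toFun s) (L θ) (μ θ))
      (continuous_mfderiv_ambientIsotopy_bundle R hμ).continuousOn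
      (continuousOn_deriv_of_contDiff_family (K := fun s => R.toFun s ∘ L)
        (contDiff_ambCurve_ambientIsotopy R hL) _) hne
  have e0 : (fun θ => mfderiv (𝓡∂ 4) (𝓡∂ 4) (R.toFun 0) (L θ) (μ θ)) = μ := by
    funext θ
    rw [R.map_zero, mfderiv_id]
    rfl
  rw [e0, R.map_zero, Function.id_comp] at key
  exact key.symm

end Summit.SmoothPoincare4.SmoothPoincare4.Theorems.AcyclicBisectionExists.ModpBraidOrbits

end
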